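import Literature.AlgebraicGeometry.Motives.HodgeLieWeightOneRankFourCube
import HarnessLib

/-!
# Weight-one Hodge structures with Hodge group of rank four, not of CM type. F: the corner of `End_Hdg(V)` at
# `ker φ` is a central simple algebra of dimension `(dim ker φ / 2)²` with centre `ℚ`

Family `hodge`, layer `Literature/AlgebraicGeometry/Motives`; THEOREMS ONLY (no definition, no named fact; D-0026).
Sixth file of the lane MT-RANK-FIVE of the cell `pub-hodgecm2` (setting as in `Motives/HodgeLieWeightOneRankFourBlocks`,
`dim_ℚ 𝔥 = 4`, `X ∈ 𝔥 ∖ End_Hdg(V)`; `φ` the rational central element with `φ³ = qφ`, `Φ = φ_ℂ`, `Φ E = Φ F = 0`,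
`E F = αP + βΦP`, `F E = α(1−P) − βΦ(1−P)` from `Motives/HodgeLieWeightOneRankFourCube`).

* `corner_ker_finrank_and_center` — for the corner `A' = {a ∈ End_Hdg(V) | a φ = 0}` (the Hodge endomorphisms
  supported on `ker φ`; `a φ = 0 ⟺ a = a e'` with `e' = 1 − q⁻¹φ²` the central idempotent onto `ker φ`):
  **`4 · dim_ℚ A' = (dim_ℚ ker φ)²`** and **every element of `A'` commuting with `A'` is a rational multiple of
  `e' = 1 − q⁻¹ φ²`**.  Proof: on `W = ker Φ ⊆ V_ℂ` the restrictions `P', E', F'` of `P, E, F` form an `𝔰𝔩₂`-triple in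
  isotypic position (`E'F' = αP'`, `F'E' = α(1 − P')`, as `Φ = 0` on `W`), whose commutant is `End(range P')`
  (`SL2Triple.finrank_commutant_eq_sq`, centre scalar by `SL2Triple.exists_eq_smul_one_of_mem_center_commutant`);
  restriction to `W` and extension by zero along `range Φ` identify `A' ⊗ ℂ` with that commutant (an extension
  commutes with `P, E, F, Φ`, hence lies in `End_Hdg ⊗ ℂ` by Zarhin's commutant theorem, and is killed by `Φ`);
  `2 · rk P' = dim W = dim_ℚ ker φ`.

Classically: `ker φ = H¹` of the isotypic non-CM part `B^a` of the abelian variety, on which `Hg` acts through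
`SL₂` with `End_Hdg = M_a(End⁰ B)`, `End_Hdg ⊗ ℂ ≅ M_g(ℂ)` (Moonen–Zarhin 1999 §2, (2.3)).

## References

* [MoonenZarhin1999LowDim] B. Moonen, Yu. Zarhin, *Hodge classes on abelian varieties of low dimension*, Math. Ann. 315
  (1999), §2 (2.1)–(2.3).
* [FultonHarris1991] W. Fulton, J. Harris, *Representation Theory*, GTM 129 (1991), Lecture 11 (§11.1).
* [Humphreys1972] J. E. Humphreys, *Introduction to Lie Algebras and Representation Theory*, GTM 9, §6.1 (Schur).
* [Zarhin1983HodgeGroupsK3] Yu. G. Zarhin, *Hodge groups of K3 surfaces*, J. reine angew. Math. 341 (1983), §2.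
-/

noncomputable section

open scoped TensorProduct

namespace Literature.AlgebraicGeometry.Motives

universe u

namespace HodgeStructure

open ProjectorBlocks Literature.RepresentationTheory.GeneralLinear

variable {V : Type u} [AddCommGroup V] [Module ℚ V] [Module.Finite ℚ V] [HodgeTensorFacts.{u, u}] {n : ℤ}
  {S : Type u} [Fintype S] [DecidableEq S] {deg : S → ℤ}

/-! ## The corner of `End_Hdg(V)` at `ker φ` -/

-- buildfix 2026-08-21 (ops-buildfix-1 g13): the hub `lake build` hit the default 200000-heartbeat budget inside this
-- single 330-line proof (:392 isDefEq) while the gate check passed — heartbeat-cliff class; scoped budget, proof unchanged.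
set_option maxHeartbeats 400000 in
/-- **The corner of `End_Hdg(V)` at `ker φ`** (weight one, degrees in `{0,1}`; hypotheses = the conclusions of
`exists_rat_central_cube` for a rational central `φ`: `φ ∈ 𝔥 ∩ End_Hdg(V)` central in `End_Hdg(V)`,
`𝔥_ℂ = ⟨2P−1, E, F, φ_ℂ⟩`, `φ_ℂ E = φ_ℂ F = 0`, `E F = αP + βφ_ℂP`, `F E = α(1−P) − βφ_ℂ(1−P)`, `α ≠ 0`, `φ³ = qφ`,
`q ≠ 0`).  Then for the corner `A' = {a ∈ End_Hdg(V) | a φ = 0}`: **`4 · dim_ℚ A' = (dim_ℚ ker φ)²`**, and **every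
`z ∈ A'` commuting with `A'` equals `c · (1 − q⁻¹φ²)` with `c ∈ ℚ`**.  Proof: on `W = ker φ_ℂ` the restrictions of
`P, E, F` form an `𝔰𝔩₂`-triple in isotypic position; restriction to `W` and extension by zero along `range φ_ℂ`
identify `A' ⊗ ℂ` with its commutant (Zarhin's commutant theorem for the extension), which is `End(range P|_W)` with
scalar centre (`SL2Triple.finrank_commutant_eq_sq`, `SL2Triple.exists_eq_smul_one_of_mem_center_commutant`), and
`2 rk(P|_W) = dim W = dim_ℚ ker φ`. [cite: MoonenZarhin1999LowDim, §2 (2.1)–(2.3)] [cite: FultonHarris1991, Lecture 11 (§11.1)]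
[cite: Zarhin1983HodgeGroupsK3, §2] -/
theorem corner_ker_of_rat_central (H : HodgeStructure V n) (hn : n = 1)
    (e : Module.Basis S ℂ (ℂ ⊗[ℚ] V)) (hF : ∀ a, H.F a = Submodule.span ℂ (e '' {σ | a ≤ deg σ}))
    (hFc : ∀ a, complexConj (H.F a) = Submodule.span ℂ (e '' {σ | deg σ ≤ n - a}))
    (hdeg : ∀ σ, deg σ = 0 ∨ deg σ = 1) {X : Module.End ℚ V} (hX : X ∈ H.hodgeLie) (hXE : X ∉ H.endAlg)
    {φ : Module.End ℚ V} (hφA : φ ∈ H.endAlg) (hφcA : ∀ a ∈ H.endAlg, φ * a = a * φ)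
    (hspan : ∀ W ∈ H.hodgeLieC, ∃ c : Fin 4 → ℂ, W = c 0 • ((2 : ℂ) • gradingEnd e deg - 1) +
        c 1 • (gradingEnd e deg * X.baseChange ℂ * (1 - gradingEnd e deg)) +
        c 2 • ((1 - gradingEnd e deg) * X.baseChange ℂ * gradingEnd e deg) + c 3 • φ.baseChange ℂ)
    (hΦE0 : φ.baseChange ℂ * (gradingEnd e deg * X.baseChange ℂ * (1 - gradingEnd e deg)) = 0)
    (hΦF0 : φ.baseChange ℂ * ((1 - gradingEnd e deg) * X.baseChange ℂ * gradingEnd e deg) = 0)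
    {α β : ℂ} {q : ℚ} (hα : α ≠ 0) (hq : q ≠ 0) (hq3 : φ * φ * φ = q • φ)
    (hEFc : (gradingEnd e deg * X.baseChange ℂ * (1 - gradingEnd e deg)) *
        ((1 - gradingEnd e deg) * X.baseChange ℂ * gradingEnd e deg) =
      α • gradingEnd e deg + β • (φ.baseChange ℂ * gradingEnd e deg))
    (hFEc : ((1 - gradingEnd e deg) * X.baseChange ℂ * gradingEnd e deg) *
        (gradingEnd e deg * X.baseChange ℂ * (1 - gradingEnd e deg)) =
      α • (1 - gradingEnd e deg) - β • (φ.baseChange ℂ * (1 - gradingEnd e deg))) :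
    LinearMap.ker φ ≠ ⊥ ∧
      4 * Module.finrank ℚ ↥(Subalgebra.toSubmodule H.endAlg ⊓ LinearMap.ker (LinearMap.mulRight ℚ φ)) =
        Module.finrank ℚ (LinearMap.ker φ) ^ 2 ∧
      (∀ z ∈ H.endAlg, z * φ = 0 → (∀ a ∈ H.endAlg, a * φ = 0 → z * a = a * z) →
        ∃ c : ℚ, z = c • (1 - q⁻¹ • (φ * φ))) := by
  classical
  subst hn
  set P := gradingEnd e deg with hP
  set Y := X.baseChange ℂ with hY
  set E := P * Y * (1 - P) with hEdef
  set F := (1 - P) * Y * P with hFdef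
  have hPP : P * P = P := gradingEnd_mul_gradingEnd_of_deg e hdeg
  have hPE : P * E = E := by rw [hEdef, ← mul_assoc, ← mul_assoc, hPP]
  have hEP : E * P = 0 := by rw [hEdef, mul_assoc (P * Y) (1 - P) P, sub_mul, one_mul, hPP, sub_self, mul_zero]
  have hPF : P * F = 0 := by
    rw [hFdef, mul_assoc (1 - P) Y P, ← mul_assoc P (1 - P) (Y * P), mul_sub, mul_one, hPP, sub_self, zero_mul]
  have hFP : F * P = F := by rw [hFdef, mul_assoc ((1 - P) * Y) P P, hPP]
  obtain ⟨hE0, -⟩ := projE_ne_zero_of_not_mem_endAlg H rfl e hF hFc hdeg hXE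
  rw [← hP, ← hY, ← hEdef] at hE0
  have hYM : Y ∈ H.hodgeLieC := H.baseChange_mem_hodgeLieC hX
  obtain ⟨hEM, hFM⟩ := projE_mem_hodgeLieC H e hF hFc hdeg hYM
  rw [← hP, ← hEdef] at hEM; rw [← hP, ← hFdef] at hFM
  have hΘ' : (2 : ℂ) • P - 1 ∈ H.hodgeLieC := by
    simpa only [Int.cast_one, one_smul] using two_smul_gradingEnd_sub_mem_hodgeLieC H e hF hFc
  set Φ := φ.baseChange ℂ with hΦdef
  have hΦcen : ∀ W ∈ H.hodgeLieC, Φ * W = W * Φ :=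
    fun W hW => (commute_baseChange_of_mem_hodgeLieC H hW ⟨φ, hφA⟩).symm
  have hΦP : Φ * P = P * Φ := by
    have h := hΦcen _ hΘ'
    rw [mul_sub Φ _ 1, sub_mul _ 1 Φ, mul_one, one_mul, mul_smul_comm, smul_mul_assoc, sub_left_inj] at h
    exact smul_right_injective _ (two_ne_zero' ℂ) h
  have hΦQ : Φ * (1 - P) = (1 - P) * Φ := by rw [mul_sub, sub_mul, mul_one, one_mul, hΦP]
  have hEΦ : E * Φ = 0 := by rw [← hΦcen _ hEM, hΦE0]
  have hFΦ : F * Φ = 0 := by rw [← hΦcen _ hFM, hΦF0]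
  have hq0 : (q : ℂ) ≠ 0 := by exact_mod_cast hq
  have hΦ3 : Φ * Φ * Φ = (q : ℂ) • Φ := by
    rw [hΦdef, ← LinearMap.baseChange_mul, ← LinearMap.baseChange_mul, hq3, baseChange_ratCast_smul]
  -- the rational and complex projectors onto `ker φ`
  set eQ : Module.End ℚ V := 1 - q⁻¹ • (φ * φ) with heQ
  set ee : Module.End ℂ (ℂ ⊗[ℚ] V) := 1 - (q : ℂ)⁻¹ • (Φ * Φ) with hee
  have hee' : ee = eQ.baseChange ℂ := by
    rw [heQ, LinearMap.baseChange_sub, baseChange_ratCast_smul, LinearMap.baseChange_mul, ← hΦdef, Rat.cast_inv,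
      Module.End.one_eq_id, LinearMap.baseChange_id, ← Module.End.one_eq_id]
  have hΦee : Φ * ee = 0 := by
    rw [hee, mul_sub, mul_one, mul_smul_comm, ← mul_assoc, hΦ3, smul_smul, inv_mul_cancel₀ hq0, one_smul, sub_self]
  have heeΦ : ee * Φ = 0 := by
    rw [hee, sub_mul, one_mul, smul_mul_assoc, hΦ3, smul_smul, inv_mul_cancel₀ hq0, one_smul, sub_self]
  have hee_of_ker : ∀ w, Φ w = 0 → ee w = w := by
    intro w hw
    rw [hee, LinearMap.sub_apply, Module.End.one_apply, LinearMap.smul_apply, Module.End.mul_apply, hw, map_zero,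
      smul_zero, sub_zero]
  have hEee : ee * E = E := by rw [hee, sub_mul, one_mul, smul_mul_assoc, mul_assoc, hΦE0, mul_zero, smul_zero, sub_zero]
  have hFee : ee * F = F := by rw [hee, sub_mul, one_mul, smul_mul_assoc, mul_assoc, hΦF0, mul_zero, smul_zero, sub_zero]
  have hEee' : E * ee = E := by rw [hee, mul_sub, mul_one, mul_smul_comm, ← mul_assoc, hEΦ, zero_mul, smul_zero, sub_zero]
  have hFee' : F * ee = F := by rw [hee, mul_sub, mul_one, mul_smul_comm, ← mul_assoc, hFΦ, zero_mul, smul_zero, sub_zero]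
  have hPee : P * ee = ee * P := by
    rw [hee, mul_sub, sub_mul, mul_one, one_mul, mul_smul_comm, smul_mul_assoc, ← mul_assoc, ← hΦP, mul_assoc Φ P Φ,
      ← hΦP, ← mul_assoc]
  -- `W = ker Φ` and the restricted triple
  set W : Submodule ℂ (ℂ ⊗[ℚ] V) := LinearMap.ker Φ with hWdef
  have hWmem : ∀ x, x ∈ W ↔ Φ x = 0 := fun x => by rw [hWdef, LinearMap.mem_ker]
  have hPW : ∀ x ∈ W, P x ∈ W := by
    intro x hx
    rw [hWmem] at hx ⊢
    rw [← Module.End.mul_apply, hΦP, Module.End.mul_apply, hx, map_zero]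
  have hEW : ∀ x, E x ∈ W := fun x => by rw [hWmem, ← Module.End.mul_apply, hΦE0, LinearMap.zero_apply]
  have hFW : ∀ x, F x ∈ W := fun x => by rw [hWmem, ← Module.End.mul_apply, hΦF0, LinearMap.zero_apply]
  set P' : Module.End ℂ W := P.restrict hPW with hP'
  set E' : Module.End ℂ W := E.restrict fun x _ => hEW x with hE'
  set F' : Module.End ℂ W := F.restrict fun x _ => hFW x with hF'
  have hcoe : ∀ (T : Module.End ℂ (ℂ ⊗[ℚ] V)) (hT : ∀ x ∈ W, T x ∈ W) (w : W),
      ((T.restrict hT w : W) : ℂ ⊗[ℚ] V) = T w := fun T hT w => rfl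
  have hmul_coe : ∀ (T₁ T₂ : Module.End ℂ (ℂ ⊗[ℚ] V)) (h₁ : ∀ x ∈ W, T₁ x ∈ W) (h₂ : ∀ x ∈ W, T₂ x ∈ W) (w : W),
      (((T₁.restrict h₁ * T₂.restrict h₂) w : W) : ℂ ⊗[ℚ] V) = (T₁ * T₂) w := fun T₁ T₂ h₁ h₂ w => rfl
  have hPP' : P' * P' = P' := LinearMap.ext fun w => Subtype.ext (by rw [hmul_coe, hPP]; rfl)
  have hPE' : P' * E' = E' := LinearMap.ext fun w => Subtype.ext (by rw [hmul_coe, hPE]; rfl)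
  have hEP' : E' * P' = 0 := LinearMap.ext fun w => Subtype.ext (by rw [hmul_coe, hEP]; rfl)
  have hPF' : P' * F' = 0 := LinearMap.ext fun w => Subtype.ext (by rw [hmul_coe, hPF]; rfl)
  have hFP' : F' * P' = F' := LinearMap.ext fun w => Subtype.ext (by rw [hmul_coe, hFP]; rfl)
  have hEF' : E' * F' = α • P' := LinearMap.ext fun w => Subtype.ext (by
    rw [hmul_coe, hEFc, LinearMap.add_apply, LinearMap.smul_apply, LinearMap.smul_apply, Module.End.mul_apply,
      ← Module.End.mul_apply Φ P, hΦP, Module.End.mul_apply, (hWmem _).1 w.2, map_zero, smul_zero, add_zero]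
    rfl)
  have hFE' : F' * E' = α • (1 - P') := LinearMap.ext fun w => Subtype.ext (by
    rw [hmul_coe, hFEc, LinearMap.sub_apply, LinearMap.smul_apply, LinearMap.smul_apply, Module.End.mul_apply,
      ← Module.End.mul_apply Φ (1 - P), hΦQ, Module.End.mul_apply, (hWmem _).1 w.2, map_zero, smul_zero, sub_zero]
    rfl)
  -- the commutant of the restricted triple
  let C' : Submodule ℂ (Module.End ℂ W) :=
    { carrier := {T | T * P' = P' * T ∧ T * E' = E' * T ∧ T * F' = F' * T}
      add_mem' := fun {a b} ha hb =>
        ⟨by rw [add_mul, mul_add, ha.1, hb.1], by rw [add_mul, mul_add, ha.2.1, hb.2.1],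
          by rw [add_mul, mul_add, ha.2.2, hb.2.2]⟩
      zero_mem' := ⟨by rw [zero_mul, mul_zero], by rw [zero_mul, mul_zero], by rw [zero_mul, mul_zero]⟩
      smul_mem' := fun c a ha =>
        ⟨by rw [smul_mul_assoc, mul_smul_comm, ha.1], by rw [smul_mul_assoc, mul_smul_comm, ha.2.1],
          by rw [smul_mul_assoc, mul_smul_comm, ha.2.2]⟩ }
  have hC' : ∀ T, T ∈ C' ↔ T * P' = P' * T ∧ T * E' = E' * T ∧ T * F' = F' * T := fun T => Iff.rfl
  -- the rational corner and its complexification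
  set A' : Submodule ℚ (Module.End ℚ V) := Subalgebra.toSubmodule H.endAlg ⊓ LinearMap.ker (LinearMap.mulRight ℚ φ)
    with hA'def
  have hA' : ∀ a, a ∈ A' ↔ a ∈ H.endAlg ∧ a * φ = 0 := by
    intro a
    simp only [hA'def, Submodule.mem_inf, Subalgebra.mem_toSubmodule, LinearMap.mem_ker, LinearMap.mulRight_apply]
  set A'c : Submodule ℂ (Module.End ℂ (ℂ ⊗[ℚ] V)) :=
    Submodule.span ℂ ((fun a : Module.End ℚ V => a.baseChange ℂ) '' (A' : Set (Module.End ℚ V))) with hA'cdef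
  -- elements of `A'c` commute with `P, E, F` and are killed by `Φ` on both sides
  have hA'c : ∀ T ∈ A'c, T * P = P * T ∧ T * E = E * T ∧ T * F = F * T ∧ T * Φ = 0 ∧ Φ * T = 0 := by
    intro T hT
    induction hT using Submodule.span_induction with
    | mem T hT =>
      obtain ⟨a, ha, rfl⟩ := hT
      obtain ⟨haA, haφ⟩ := (hA' a).1 ha
      have hcomm : ∀ Z ∈ H.hodgeLieC, a.baseChange ℂ * Z = Z * a.baseChange ℂ :=
        fun Z hZ => (commute_baseChange_of_mem_hodgeLieC H hZ ⟨a, haA⟩).symm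
      have haP : a.baseChange ℂ * P = P * a.baseChange ℂ := by
        have h := hcomm _ hΘ'
        rw [mul_sub _ _ (1 : Module.End ℂ (ℂ ⊗[ℚ] V)), sub_mul _ (1 : Module.End ℂ (ℂ ⊗[ℚ] V)), mul_one, one_mul,
          mul_smul_comm, smul_mul_assoc, sub_left_inj] at h
        exact smul_right_injective _ (two_ne_zero' ℂ) h
      have haΦ : a.baseChange ℂ * Φ = 0 := by rw [hΦdef, ← LinearMap.baseChange_mul, haφ, LinearMap.baseChange_zero]
      refine ⟨haP, hcomm _ hEM, hcomm _ hFM, haΦ, ?_⟩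
      rw [← haΦ, hΦdef, ← LinearMap.baseChange_mul, ← LinearMap.baseChange_mul, hφcA a haA]
    | zero => simp
    | add x y _ _ hx hy =>
      exact ⟨by rw [add_mul, mul_add, hx.1, hy.1], by rw [add_mul, mul_add, hx.2.1, hy.2.1],
        by rw [add_mul, mul_add, hx.2.2.1, hy.2.2.1], by rw [add_mul, hx.2.2.2.1, hy.2.2.2.1, add_zero],
        by rw [mul_add, hx.2.2.2.2, hy.2.2.2.2, add_zero]⟩
    | smul c x _ hx =>
      exact ⟨by rw [smul_mul_assoc, mul_smul_comm, hx.1], by rw [smul_mul_assoc, mul_smul_comm, hx.2.1],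
        by rw [smul_mul_assoc, mul_smul_comm, hx.2.2.1], by rw [smul_mul_assoc, hx.2.2.2.1, smul_zero],
        by rw [mul_smul_comm, hx.2.2.2.2, smul_zero]⟩
  -- an operator commuting with `P, E, F, Φ` lies in `End_Hdg ⊗ ℂ`; multiplied by `ee` it lies in `A'c`
  have hmemA : ∀ T : Module.End ℂ (ℂ ⊗[ℚ] V), T * P = P * T → T * E = E * T → T * F = F * T → T * Φ = Φ * T →
      T ∈ Submodule.span ℂ ((fun a : Module.End ℚ V => a.baseChange ℂ) '' (H.endAlg : Set (Module.End ℚ V))) := by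
    intro T hTP hTE hTF hTΦ
    refine H.mem_span_endAlg_of_forall_commute fun X' hX' => ?_
    obtain ⟨c, hc⟩ := hspan _ (H.baseChange_mem_hodgeLieC hX')
    have hTΘ : T * ((2 : ℂ) • P - 1) = ((2 : ℂ) • P - 1) * T := by
      rw [mul_sub T _ 1, sub_mul _ 1 T, mul_smul_comm, smul_mul_assoc, hTP, mul_one, one_mul]
    rw [hc]
    simp only [mul_add, add_mul, mul_smul_comm, smul_mul_assoc, hTΘ, hTE, hTF, hTΦ]
  have hmemA'c : ∀ T ∈ Submodule.span ℂ ((fun a : Module.End ℚ V => a.baseChange ℂ) '' (H.endAlg : Set (Module.End ℚ V))),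
      T * ee ∈ A'c := by
    intro T hT
    induction hT using Submodule.span_induction with
    | mem T hT =>
      obtain ⟨a, ha, rfl⟩ := hT
      have hmem : a * eQ ∈ A' := by
        refine (hA' _).2 ⟨H.endAlg.mul_mem ha (H.endAlg.sub_mem (Subalgebra.one_mem _)
          (H.endAlg.smul_mem (H.endAlg.mul_mem hφA hφA) _)), ?_⟩
        rw [heQ, mul_sub, sub_mul, mul_one, mul_smul_comm, smul_mul_assoc, mul_assoc a (φ * φ) φ, hq3,
          mul_smul_comm, smul_smul, inv_mul_cancel₀ hq, one_smul, sub_self]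
      rw [hee', ← LinearMap.baseChange_mul]
      exact Submodule.subset_span ⟨a * eQ, hmem, rfl⟩
    | zero => rw [zero_mul]; exact A'c.zero_mem
    | add x y _ _ hx hy => rw [add_mul]; exact A'c.add_mem hx hy
    | smul c x _ hx => rw [smul_mul_assoc]; exact A'c.smul_mem c hx
  -- extension by zero along `range Φ`
  set πW : (ℂ ⊗[ℚ] V) →ₗ[ℂ] W := LinearMap.codRestrict W ee (fun x => by
    rw [hWmem, ← Module.End.mul_apply, hΦee, LinearMap.zero_apply]) with hπW
  have hπW_coe : ∀ x, ((πW x : W) : ℂ ⊗[ℚ] V) = ee x := fun x => rfl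
  have hπW_W : ∀ w : W, πW (w : ℂ ⊗[ℚ] V) = w := fun w => Subtype.ext (by rw [hπW_coe, hee_of_ker _ ((hWmem _).1 w.2)])
  have hext_apply : ∀ (S' : Module.End ℂ W) (x : ℂ ⊗[ℚ] V),
      (W.subtype ∘ₗ S' ∘ₗ πW) x = ((S' (πW x) : W) : ℂ ⊗[ℚ] V) := fun S' x => rfl
  have hext_mem : ∀ S' ∈ C', W.subtype ∘ₗ S' ∘ₗ πW ∈ A'c := by
    intro S' hS'
    obtain ⟨hSP, hSE, hSF⟩ := (hC' S').1 hS'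
    set T := W.subtype ∘ₗ S' ∘ₗ πW with hTdef
    have hTΦ0 : T * Φ = 0 := by
      refine LinearMap.ext fun x => ?_
      have h0 : πW (Φ x) = 0 := Subtype.ext (by rw [hπW_coe, ← Module.End.mul_apply, heeΦ]; rfl)
      rw [Module.End.mul_apply, hext_apply, h0, map_zero, LinearMap.zero_apply]; rfl
    have hΦT0 : Φ * T = 0 := by
      refine LinearMap.ext fun x => ?_
      rw [Module.End.mul_apply, hext_apply, LinearMap.zero_apply]
      exact (hWmem _).1 (S' (πW x)).2
    have hcommW : ∀ (R : Module.End ℂ (ℂ ⊗[ℚ] V)) (hR : ∀ x ∈ W, R x ∈ W), S' * R.restrict hR = R.restrict hR * S' →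
        R * ee = ee * R → T * R = R * T := by
      intro R hR hSR hRee
      refine LinearMap.ext fun x => ?_
      rw [Module.End.mul_apply, Module.End.mul_apply, hext_apply, hext_apply]
      have h1 : πW (R x) = R.restrict hR (πW x) := Subtype.ext (by
        rw [hπW_coe, hcoe, hπW_coe, ← Module.End.mul_apply, ← hRee, Module.End.mul_apply])
      rw [h1, ← Module.End.mul_apply S', hSR, Module.End.mul_apply, hcoe]
    have hTP : T * P = P * T := hcommW P hPW hSP hPee
    have hTE : T * E = E * T := hcommW E (fun x _ => hEW x) hSE (by rw [hEee, hEee'])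
    have hTF : T * F = F * T := hcommW F (fun x _ => hFW x) hSF (by rw [hFee, hFee'])
    have hTee : T * ee = T := by
      rw [hee, mul_sub, mul_one, mul_smul_comm, ← mul_assoc, hTΦ0, zero_mul, smul_zero, sub_zero]
    rw [← hTee]
    exact hmemA'c T (hmemA T hTP hTE hTF (by rw [hTΦ0, hΦT0]))
  -- elements of `A'c` preserve `W`; restriction and extension are mutually inverse
  have hA'cW : ∀ T ∈ A'c, ∀ x ∈ W, T x ∈ W := by
    intro T hT x _
    rw [hWmem, ← Module.End.mul_apply, (hA'c T hT).2.2.2.2, LinearMap.zero_apply]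
  have hres_mem : ∀ T (hT : T ∈ A'c), T.restrict (hA'cW T hT) ∈ C' := by
    intro T hT
    obtain ⟨hTP, hTE, hTF, -, -⟩ := hA'c T hT
    exact (hC' _).2 ⟨LinearMap.ext fun w => Subtype.ext (by rw [hmul_coe, hmul_coe, hTP]),
      LinearMap.ext fun w => Subtype.ext (by rw [hmul_coe, hmul_coe, hTE]),
      LinearMap.ext fun w => Subtype.ext (by rw [hmul_coe, hmul_coe, hTF])⟩
  have hext_res : ∀ T (hT : T ∈ A'c), W.subtype ∘ₗ T.restrict (hA'cW T hT) ∘ₗ πW = T := by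
    intro T hT
    refine LinearMap.ext fun x => ?_
    rw [hext_apply, hcoe, hπW_coe, ← Module.End.mul_apply, hee, mul_sub, mul_one, mul_smul_comm, ← mul_assoc,
      (hA'c T hT).2.2.2.1, zero_mul, smul_zero, sub_zero]
  have hres_ext : ∀ (S' : Module.End ℂ W) (hT : ∀ x ∈ W, (W.subtype ∘ₗ S' ∘ₗ πW) x ∈ W),
      (W.subtype ∘ₗ S' ∘ₗ πW).restrict hT = S' := by
    intro S' hT
    refine LinearMap.ext fun w => Subtype.ext ?_
    rw [hcoe, hext_apply, hπW_W]
  -- the linear equivalence `C' ≃ A'c`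
  let Ψ : C' ≃ₗ[ℂ] A'c :=
    { toFun := fun S' => ⟨W.subtype ∘ₗ (S' : Module.End ℂ W) ∘ₗ πW, hext_mem _ S'.2⟩
      map_add' := fun S₁ S₂ => Subtype.ext (by
        change W.subtype ∘ₗ ((S₁ : Module.End ℂ W) + (S₂ : Module.End ℂ W)) ∘ₗ πW = _
        rw [LinearMap.add_comp, LinearMap.comp_add]; rfl)
      map_smul' := fun c S₁ => Subtype.ext (by
        change W.subtype ∘ₗ (c • (S₁ : Module.End ℂ W)) ∘ₗ πW = _
        rw [LinearMap.smul_comp, LinearMap.comp_smul]; rfl)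
      invFun := fun T => ⟨(T : Module.End ℂ (ℂ ⊗[ℚ] V)).restrict (hA'cW _ T.2), hres_mem _ T.2⟩
      left_inv := fun S' => Subtype.ext (hres_ext _ (hA'cW _ (hext_mem _ S'.2)))
      right_inv := fun T => Subtype.ext (hext_res _ T.2) }
  -- dimension count
  have hdimC' := SL2Triple.finrank_commutant_eq_sq hα hPP' hPE' hEP' hPF' hFP' hEF' hFE' hC'
  have hdimA' : Module.finrank ℂ A'c = Module.finrank ℚ A' := finrank_span_baseChange_image A'
  have hW_eq : Module.finrank ℂ W = Module.finrank ℚ (LinearMap.ker φ) := by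
    have h1 := LinearMap.finrank_range_add_finrank_ker Φ
    have h2 := LinearMap.finrank_range_add_finrank_ker φ
    rw [Module.finrank_baseChange] at h1
    have h3 : Module.finrank ℂ (LinearMap.range Φ) = Module.finrank ℚ (LinearMap.range φ) := by
      rw [hΦdef, range_baseChange, finrank_submodule_baseChange]
    rw [hWdef]
    omega
  have h2P : 2 * Module.finrank ℂ (LinearMap.range P') = Module.finrank ℂ W := by
    have h1 : Module.finrank ℂ (LinearMap.range P') ≤ Module.finrank ℂ (LinearMap.ker P') := by
      have hle : LinearMap.range P' ≤ (LinearMap.ker P').map E' := by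
        rintro _ ⟨u, rfl⟩
        refine ⟨α⁻¹ • F' u, ?_, ?_⟩
        · rw [SetLike.mem_coe, LinearMap.mem_ker, map_smul, ← Module.End.mul_apply, hPF', LinearMap.zero_apply,
            smul_zero]
        · rw [map_smul, ← Module.End.mul_apply, hEF', LinearMap.smul_apply, smul_smul, inv_mul_cancel₀ hα, one_smul]
      exact (Submodule.finrank_mono hle).trans (Submodule.finrank_map_le _ _)
    have h2 : Module.finrank ℂ (LinearMap.ker P') ≤ Module.finrank ℂ (LinearMap.range P') := by
      have hle : LinearMap.ker P' ≤ (LinearMap.range P').map F' := by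
        intro u hu
        rw [LinearMap.mem_ker] at hu
        refine ⟨α⁻¹ • E' u, ⟨α⁻¹ • E' u, ?_⟩, ?_⟩
        · rw [map_smul, ← Module.End.mul_apply, hPE']
        · rw [map_smul, ← Module.End.mul_apply, hFE', LinearMap.smul_apply, LinearMap.sub_apply, Module.End.one_apply,
            hu, sub_zero, smul_smul, inv_mul_cancel₀ hα, one_smul]
      exact (Submodule.finrank_mono hle).trans (Submodule.finrank_map_le _ _)
    have hrn := LinearMap.finrank_range_add_finrank_ker P'
    omega
  -- `ker φ ≠ 0`, `ee ≠ 0`, `P' ≠ 0`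
  obtain ⟨x₀, hx₀⟩ : ∃ x, E x ≠ 0 := by
    by_contra h
    push Not at h
    exact hE0 (LinearMap.ext fun x => by rw [h x, LinearMap.zero_apply])
  have hker : LinearMap.ker φ ≠ ⊥ := by
    intro hbot
    have hW0 : Module.finrank ℂ W = 0 := by rw [hW_eq, hbot, finrank_bot]
    haveI : Module.Finite ℂ W := Module.Finite.of_injective W.subtype Subtype.val_injective
    have hWbot : W = ⊥ := Submodule.finrank_eq_zero.1 hW0
    have h := hEW x₀
    rw [hWbot, Submodule.mem_bot] at h
    exact hx₀ h
  have heQ0 : eQ ≠ 0 := by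
    intro h
    apply hx₀
    rw [← hee_of_ker _ ((hWmem _).1 (hEW x₀)), hee', h, LinearMap.baseChange_zero, LinearMap.zero_apply]
  have hP'0 : P' ≠ 0 := by
    intro h
    apply hx₀
    have h' := congrArg Subtype.val (show P' ⟨E x₀, hEW x₀⟩ = 0 by rw [h, LinearMap.zero_apply])
    rw [hcoe] at h'
    change P (E x₀) = (0 : ℂ ⊗[ℚ] V) at h'
    rw [← Module.End.mul_apply, hPE] at h'
    exact h'
  refine ⟨hker, ?_, ?_⟩
  · rw [← hdimA', ← Ψ.finrank_eq, hdimC', ← hW_eq, ← h2P]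
    ring
  · -- the centre of the corner
    intro z hz hzφ hzc
    have hzA' : z ∈ A' := (hA' z).2 ⟨hz, hzφ⟩
    have hZc : z.baseChange ℂ ∈ A'c := Submodule.subset_span ⟨z, hzA', rfl⟩
    have hzcen : ∀ S' ∈ C', (z.baseChange ℂ).restrict (hA'cW _ hZc) * S' = S' * (z.baseChange ℂ).restrict (hA'cW _ hZc) := by
      intro S' hS'
      have hT := hext_mem S' hS'
      have hcomm : z.baseChange ℂ * (W.subtype ∘ₗ S' ∘ₗ πW) = (W.subtype ∘ₗ S' ∘ₗ πW) * z.baseChange ℂ := by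
        refine Submodule.span_induction (p := fun T _ => z.baseChange ℂ * T = T * z.baseChange ℂ) ?_ ?_ ?_ ?_ hT
        · rintro _ ⟨a, ha, rfl⟩
          obtain ⟨haA, haφ⟩ := (hA' a).1 ha
          rw [← LinearMap.baseChange_mul, ← LinearMap.baseChange_mul, hzc a haA haφ]
        · rw [mul_zero, zero_mul]
        · intro x y _ _ hx hy; rw [mul_add, add_mul, hx, hy]
        · intro c x _ hx; rw [mul_smul_comm, smul_mul_assoc, hx]
      have key : (z.baseChange ℂ).restrict (hA'cW _ hZc) * (W.subtype ∘ₗ S' ∘ₗ πW).restrict (hA'cW _ hT) =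
          (W.subtype ∘ₗ S' ∘ₗ πW).restrict (hA'cW _ hT) * (z.baseChange ℂ).restrict (hA'cW _ hZc) :=
        LinearMap.ext fun w => Subtype.ext (by rw [hmul_coe, hmul_coe, hcomm])
      rwa [hres_ext] at key
    obtain ⟨c, hc⟩ := SL2Triple.exists_eq_smul_one_of_mem_center_commutant hα hPP' hPE' hEP' hPF' hFP' hEF' hFE'
      hP'0 hC' (hres_mem _ hZc) hzcen
    -- `z_ℂ = c • ee`
    have hzee : z.baseChange ℂ = c • eQ.baseChange ℂ := by
      rw [← hext_res _ hZc, hc, ← hee']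
      refine LinearMap.ext fun x => ?_
      rw [hext_apply, LinearMap.smul_apply, Module.End.one_apply, LinearMap.smul_apply, Submodule.coe_smul, hπW_coe]
    obtain ⟨c', hc'⟩ := exists_ratCast_eq_of_baseChange_eq_smul heQ0 hzee
    refine ⟨c', ?_⟩
    rw [← sub_eq_zero]
    apply eq_zero_of_baseChange_eq_zero
    rw [LinearMap.baseChange_sub, baseChange_ratCast_smul, hc', ← hzee, sub_self]

end HodgeStructure

end Literature.AlgebraicGeometry.Motives

end
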